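import Mathlib
import HarnessLib
import Summits.Parity.GeneralizedHardyLittlewood.Theorems.LiouvilleShiftedTablesEngineToPairsTIIOfX1Part5

/-!
# `stub_TII_of_X1`, part 6: `DilatedTableChowla → TIIBudget` (line `Sketch`, crux `EngineToPairs`)

Last file of the Type-II leaf of the correlation sieve for the crux `EngineToPairs`
(stmt-Parity-14659): the registered stub `stub_TII_of_X1` itself.  Given `h ≥ 1`, `0 < δ ≤ 1/100`,
`0 < ε₁ ≤ δ/5`, `B` and `A > 0`, choose `C' = ⌈2A⌉ + 2^5 + 2^{8B+5}`, `η = (log x)^{−C'}`, the saving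
`K = A + 1 + (2·2^{2B+1} + C' + 1)/2` in the family bound of part 2 (applied at the two window
parameters `2δ/5` and `δ`), `X = x^{1/3+δ}` and the `(1+η)`-adic blocks of part 4; then for
`x ≥ x₀` (the two X1 thresholds, `e`, `4`, `4^{10/δ}`, `2h+1`) the separation `hyperbolic_decomp`,
the rectangle total `rect_total_le` and the band total `band_final_le` give
`TypeIIFam (moduliH h (x^ε₁)) (shiftWeight h) x (δ/2) (1/3+δ/2) B ((c_R + c_B) x/(log x)^A)`.
-/

noncomputable section

namespace Summit.Parity.GeneralizedHardyLittlewood.Theorems.EngineToPairs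

open Finset Real TIIOfX1
open scoped ArithmeticFunction.sigma
open Summit.Parity.GeneralizedHardyLittlewood.Theses.LiouvilleShiftedTables

/-- The thresholds in `x` used by the assembly: from `x ≥ 4` and `x ≥ 4^{10/δ}`,
`2 x^{1/3+δ} ≤ x` and `x^{2δ/5} ≤ (x/2)^{δ/2}/2`. [folklore] -/
theorem thresholds {x δ : ℝ} (hδ : 0 < δ) (hδ' : δ ≤ 1 / 100) (hx4 : 4 ≤ x)
    (hx4δ : (4 : ℝ) ^ (10 / δ) ≤ x) :
    2 * x ^ (1 / 3 + δ) ≤ x ∧ x ^ (2 * δ / 5) ≤ (x / 2) ^ (δ / 2) / 2 := by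
  have hx1 : (1 : ℝ) ≤ x := by linarith
  have hx0 : (0 : ℝ) < x := by linarith
  constructor
  · have hs4 : Real.sqrt 4 = 2 := by
      rw [show (4 : ℝ) = 2 ^ 2 by norm_num, Real.sqrt_sq (by norm_num)]
    have hhalf : (2 : ℝ) ≤ x ^ (1 / 2 : ℝ) := by
      rw [← Real.sqrt_eq_rpow, ← hs4]
      exact Real.sqrt_le_sqrt hx4
    have hexp : x ^ (1 / 2 : ℝ) ≤ x ^ (2 / 3 - δ) :=
      Real.rpow_le_rpow_of_exponent_le hx1 (by linarith)
    have hsplit : x = x ^ (1 / 3 + δ) * x ^ (2 / 3 - δ) := by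
      rw [← Real.rpow_add hx0, show (1 / 3 + δ + (2 / 3 - δ) : ℝ) = 1 by ring, Real.rpow_one]
    have h0 : 0 ≤ x ^ (1 / 3 + δ) := by positivity
    calc 2 * x ^ (1 / 3 + δ) ≤ x ^ (2 / 3 - δ) * x ^ (1 / 3 + δ) :=
          mul_le_mul_of_nonneg_right (hhalf.trans hexp) h0
      _ = x := by rw [mul_comm]; exact hsplit.symm
  · have h4 : (4 : ℝ) ≤ x ^ (δ / 10) := by
      have := Real.rpow_le_rpow (by positivity) hx4δ (by positivity : (0 : ℝ) ≤ δ / 10)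
      rwa [← Real.rpow_mul (by norm_num), show (10 / δ * (δ / 10) : ℝ) = 1 by field_simp,
        Real.rpow_one] at this
    have hsplit : x ^ (δ / 2) = x ^ (2 * δ / 5) * x ^ (δ / 10) := by
      rw [← Real.rpow_add hx0]
      congr 1
      ring
    have h2pow : (2 : ℝ) ^ (δ / 2) ≤ 2 := by
      calc (2 : ℝ) ^ (δ / 2) ≤ (2 : ℝ) ^ (1 : ℝ) :=
            Real.rpow_le_rpow_of_exponent_le (by norm_num) (by linarith)
        _ = 2 := Real.rpow_one 2
    have h2pow0 : (0 : ℝ) < (2 : ℝ) ^ (δ / 2) := by positivity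
    have hM1 : x ^ (δ / 2) / 2 ≤ (x / 2) ^ (δ / 2) := by
      rw [Real.div_rpow hx0.le (by norm_num)]
      exact div_le_div_of_nonneg_left (by positivity) h2pow0 h2pow
    have hM2 : x ^ (2 * δ / 5) * 4 ≤ x ^ (δ / 2) := by
      rw [hsplit]
      exact mul_le_mul_of_nonneg_left h4 (by positivity)
    linarith

/-- The number of `(1+η)`-adic blocks: `M ≤ log X/log(1+η) + 1 ≤ 3 (log x)^{C'+1}` for
`η = (log x)^{−C'}`, `1 ≤ X ≤ x`, `log x ≥ 1`. [folklore] -/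
theorem blocks_count_le {x X η : ℝ} {M C' : ℕ} (hL1 : 1 ≤ Real.log x) (hX1 : 1 ≤ X) (hXx : X ≤ x)
    (hηdef : η = 1 / Real.log x ^ C') (hη0 : 0 < η) (hη1 : η ≤ 1)
    (hM3 : (M : ℝ) ≤ Real.log X / Real.log (1 + η) + 1) :
    (M : ℝ) ≤ 3 * Real.log x ^ (C' + 1) := by
  have hLpos : 0 < Real.log x := by linarith
  have hXpos : 0 < X := by linarith
  have hlog1 : η / 2 ≤ Real.log (1 + η) :=
    Literature.NumberTheory.Sieve.BFI.half_le_log_one_add hη0.le hη1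
  have hlogX : Real.log X ≤ Real.log x := Real.log_le_log hXpos hXx
  have h1 : Real.log X / Real.log (1 + η) ≤ Real.log x / (η / 2) :=
    div_le_div₀ hLpos.le hlogX (by positivity) hlog1
  have h2 : Real.log x / (η / 2) = 2 * Real.log x ^ (C' + 1) := by
    rw [hηdef, pow_succ]
    field_simp
  have h3 : (1 : ℝ) ≤ Real.log x ^ (C' + 1) := one_le_pow₀ hL1
  linarith

/-- **The Type-II budget from X1** (`stub_TII_of_X1` of the registered skeleton of line `Sketch`):
`DilatedTableChowla → TIIBudget`.  Class blocks and the fourth moment per modulus (part 1), Hölder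
over the dilations against X1 at the two window parameters `2δ/5` and `δ` (part 2), separation of the
product condition `x/2 < mn ≤ x` by `(1+η)`-boxes with `η = (log x)^{−C'}` (part 4), the band terms by
divisor bookkeeping (parts 3, 5), assembled here. [this line] -/
theorem stub_TII_of_X1 : DilatedTableChowla → TIIBudget := by
  intro hX1 h hh δ hδ hδ' ε₁ hε₁ hε₁' B A hA
  -- divisor power sums
  obtain ⟨c₁, hc₁, hτ1⟩ := Literature.NumberTheory.Sieve.exists_sum_sigma_zero_pow_le_real (2 * B)
  obtain ⟨c₃, hc₃, hτ3⟩ :=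
    Literature.NumberTheory.Sieve.exists_sum_sigma_zero_pow_div_le_real (2 * B)
  obtain ⟨c₅, hc₅, hτ5⟩ := Literature.NumberTheory.Sieve.exists_sum_sigma_zero_pow_le_real 4
  obtain ⟨c₆, hc₆, hτ6⟩ :=
    Literature.NumberTheory.Sieve.exists_sum_sigma_zero_pow_le_real (8 * B + 4)
  -- exponents and constants (opaque, with their defining equations)
  obtain ⟨C', hC'⟩ : ∃ C' : ℕ, C' = ⌈2 * A⌉₊ + (2 ^ (4 + 1) + 2 ^ (8 * B + 4 + 1)) := ⟨_, rfl⟩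
  obtain ⟨nn, hnn⟩ : ∃ nn : ℕ, nn = 2 ^ (2 * B + 1) + (C' + 1) + 2 ^ (2 * B + 1) := ⟨_, rfl⟩
  obtain ⟨K, hK⟩ : ∃ K : ℝ, K = A + 1 + (nn : ℝ) / 2 := ⟨_, rfl⟩
  have hKpos : 0 < K := by rw [hK]; positivity
  have hδ25 : 0 < 2 * δ / 5 := by positivity
  have hδ25' : 2 * δ / 5 ≤ 1 / 12 := by linarith
  have hδ12 : δ ≤ 1 / 12 := by linarith
  obtain ⟨x₁, hx₁⟩ := typeII_rect_family hX1 hh hδ25 hδ25' hKpos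
  obtain ⟨x₂, hx₂⟩ := typeII_rect_family hX1 hh hδ hδ12 hKpos
  refine ⟨2 * Real.sqrt (3 * c₁ * c₃) + Real.sqrt ((2 + 2 * ((C' : ℝ) + 1) ^ C') * (c₅ + c₆) / 2),
    max (max x₁ x₂) (max (max (Real.exp 1) 4) (max ((4 : ℝ) ^ (10 / δ)) (2 * (h : ℝ) + 1))), ?_⟩
  intro x hx
  -- thresholds
  have hxx₁ : x₁ ≤ x := le_trans (le_trans (le_max_left _ _) (le_max_left _ _)) hx
  have hxx₂ : x₂ ≤ x := le_trans (le_trans (le_max_right _ _) (le_max_left _ _)) hx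
  have hxe : Real.exp 1 ≤ x :=
    le_trans (le_trans (le_trans (le_max_left _ _) (le_max_left _ _)) (le_max_right _ _)) hx
  have hx4 : (4 : ℝ) ≤ x :=
    le_trans (le_trans (le_trans (le_max_right _ _) (le_max_left _ _)) (le_max_right _ _)) hx
  have hx4δ : (4 : ℝ) ^ (10 / δ) ≤ x :=
    le_trans (le_trans (le_trans (le_max_left _ _) (le_max_right _ _)) (le_max_right _ _)) hx
  have hxh' : 2 * (h : ℝ) + 1 ≤ x :=
    le_trans (le_trans (le_trans (le_max_right _ _) (le_max_right _ _)) (le_max_right _ _)) hx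
  have hx1 : (1 : ℝ) ≤ x := by linarith
  have hx0 : (0 : ℝ) < x := by linarith
  have hx2 : (2 : ℝ) ≤ x := by linarith
  have hL1 : 1 ≤ Real.log x := by
    rw [← Real.log_exp 1]
    exact Real.log_le_log (Real.exp_pos 1) hxe
  have hLpos : 0 < Real.log x := by linarith
  have hxh : (h : ℝ) < x / 2 := by linarith
  obtain ⟨h2X', hMlow'⟩ := thresholds hδ hδ' hx4 hx4δ
  -- the box ratio `1 + η`, `η = L^{-C'}`
  obtain ⟨η, hηdef⟩ : ∃ η : ℝ, η = 1 / Real.log x ^ C' := ⟨_, rfl⟩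
  have hLC : 0 < Real.log x ^ C' := pow_pos hLpos _
  have hη0 : 0 < η := by rw [hηdef]; positivity
  have hη1 : η ≤ 1 := by
    rw [hηdef, div_le_one hLC]
    exact one_le_pow₀ hL1
  have hlam : (1 : ℝ) < 1 + η := by linarith
  unfold TypeIIFam
  intro ξ κ hξ hκ
  generalize hXdef : x ^ (δ / 2 + (1 / 3 + δ / 2)) = X
  generalize hMlowdef : (x / 2) ^ (δ / 2) = Mlow
  have hXeq : X = x ^ (1 / 3 + δ) := by rw [← hXdef]; congr 1; ring
  have hXpos : 0 < X := by rw [hXeq]; positivity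
  have hXone : 1 ≤ X := by rw [hXeq]; exact Real.one_le_rpow hx1 (by linarith)
  have h2X : 2 * X ≤ x := by rw [hXeq]; exact h2X'
  have hXx : X ≤ x := by linarith
  have hXle : X ≤ x ^ (1 / 3 + δ) := hXeq.le
  have hone : (1 : ℝ) ≤ x ^ (2 * δ / 5) := Real.one_le_rpow hx1 (by positivity)
  have hMlow : x ^ (2 * δ / 5) ≤ Mlow / 2 := by rw [← hMlowdef]; exact hMlow'
  -- the number of blocks
  obtain ⟨M, hM, -, hM3⟩ :=
    Literature.NumberTheory.Sieve.BFI.exists_geomBlocks (X := X) (lam := 1 + η) hXone hlam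
  have hMle : (M : ℝ) ≤ 3 * Real.log x ^ (C' + 1) :=
    blocks_count_le hL1 hXone hXx hηdef hη0 hη1 hM3
  -- Step 1: separation of variables, summed over the moduli
  refine (sum_le_sum fun q _ => hyperbolic_decomp (Mlow := Mlow) hx0.le hη0.le hXpos hM
    (fun m n => ξ m * κ n * shiftWeight h q (m * n))).trans ?_
  rw [sum_add_distrib, sum_comm]
  have hfinal : 2 * Real.sqrt (3 * c₁ * c₃) * x / Real.log x ^ A +
      Real.sqrt ((2 + 2 * ((C' : ℝ) + 1) ^ C') * (c₅ + c₆) / 2) * x / Real.log x ^ A =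
      (2 * Real.sqrt (3 * c₁ * c₃) + Real.sqrt ((2 + 2 * ((C' : ℝ) + 1) ^ C') * (c₅ + c₆) / 2)) *
        x / Real.log x ^ A := by
    ring
  rw [← hfinal]
  refine add_le_add ?_ ?_
  · -- Step 2: the rectangles
    exact rect_total_le hx1 hx2 hδ (by linarith) hε₁.le hε₁' hη0 hη1 hXpos h2X hXle hMlow hone
      hL1 hM hMle hnn hK hc₁ hc₃ (hx₁ x hxx₁) (hx₂ x hxx₂) hτ1 hτ3 ξ κ hξ hκ
  · -- Step 3: the bands
    exact (band_total_le X Mlow hη0.le hη1 hxh _ ξ κ hξ hκ).trans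
      (band_final_le hx1 hx2 hL1 hxh hηdef hC' hc₅ hc₆ hτ5 hτ6)

end Summit.Parity.GeneralizedHardyLittlewood.Theorems.EngineToPairs

end
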